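import Mathlib
import Summits.ValiantsHypothesis.ValiantsHypothesis.Theorems.RigidityForcesSymmetryRankRigidMinimalReprLaplaceFiveSeparatedCapturePencilCount
import Summits.ValiantsHypothesis.ValiantsHypothesis.Theorems.RigidityForcesSymmetryRankRigidMinimalReprLaplaceFiveSeparatedCaptureEqualPencil
import Summits.ValiantsHypothesis.ValiantsHypothesis.Theorems.RigidityForcesSymmetryRankRigidMinimalReprLaplaceFiveSeparatedCaptureProlongation

/-!
# ValiantsHypothesis / RigidityForcesSymmetry — crux `LaplaceOptimalFive` (stmt-ValiantsHypothesis-24813), symmetric capture: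
# ★★ **`CaptureIneqSym` FOR TWO LINES AND A SPAN OF DIMENSION ≤ 2** (profiles `(1,1,0)`, `(1,1,1)`, `(1,1,2)` — the whole `(1,1,≤2)` family)

Assembly (val-port-2 g5 ↔ crit-3 g8, 2026-08-29).  `U₀₁ = ℂ·u₁`, `U₀₂ = ℂ·u₂` (`u₁, u₂ ≠ 0` symmetric), `U₁₂` symmetric with
`finrank U₁₂ ≤ 2`, `W` symmetric zero-diagonal with every obligation captured by `L3 (ℂ∙u₁) (ℂ∙u₂) U₁₂`.  Then
`finrank W ≤ finrank (ℂ∙u₁) + finrank (ℂ∙u₂) + finrank U₁₂`: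
* `u₁ ∦ u₂`: ✓ `captureIneqSym_of_nonproportional_lines` (`finrank W ≤ 2`, brick DIR);
* `u₂ ∈ ℂu₁`: the two lines coincide; with `X := U₁₂ ⊔ ℂu₁` and `P := prolong X` (✓ `…SeparatedCaptureProlongation`, val-lit-p6 g18):
  `u₁ ∉ U₁₂` ⇒ ✓ `finrank_le_of_equalPencil_of_not_mem` and ✓ `finrank_prolong_le_one/two/four` (`finrank X ≤ finrank U₁₂ + 1`);
  `u₁ ∈ U₁₂` ⇒ ✓ `finrank_le_of_equalPencil_of_mem` with `finrank (prolong U₁₂) ≤ finrank U₁₂`.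

* `finrank_prolong_le_succ` — `finrank X ≤ 3 ⇒ finrank (prolong X) ≤ finrank X + 1` (packaging of p6's three bounds).
* ★★ `captureIneqSym_of_two_lines` — the theorem.

Honest framing.  This closes the symmetric capture inequality for the profiles with two 1-dimensional triangle spans and a third of
dimension ≤ 2 ONLY; profiles with two spans of dimension ≥ 2, `CaptureIneqSym` in general, K1 on `K₃ ⊔ K₂`, `LaplaceOptimalFive`
(OPEN · CONTESTED 72/120) and `VP ≠ VNP` are NOT proved here.  No definitions, no `sorry`.
-/

set_option linter.dupNamespace false
set_option autoImplicit false

namespace Summit.ValiantsHypothesis.ValiantsHypothesis.Theorems.RigidityForcesSymmetryRankRigidMinimalRepr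

namespace LaplaceFiveSeparatedCapture

open Finset

/-- Packaging of the prolongation bounds: `finrank X ≤ 3 ⇒ finrank X⁽¹⁾ ≤ finrank X + 1` (`1 ↦ 1`, `2 ↦ 2`, `3 ↦ 4`). [folklore] -/
theorem finrank_prolong_le_succ (X : Submodule ℂ (Fin 5 → Fin 5 → ℂ)) (hXs : ∀ x ∈ X, ∀ q r : Fin 5, x q r = x r q)
    (hX : Module.finrank ℂ X ≤ 3) : Module.finrank ℂ (prolong X) ≤ Module.finrank ℂ X + 1 := by
  by_cases h0 : Module.finrank ℂ X = 0
  · have hbot : X = ⊥ := Submodule.finrank_eq_zero.mp h0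
    rw [hbot, prolong_bot, finrank_bot]; exact Nat.zero_le _
  by_cases h1 : Module.finrank ℂ X ≤ 1
  · have := finrank_prolong_le_one X hXs h1; omega
  by_cases h2 : Module.finrank ℂ X ≤ 2
  · have := finrank_prolong_le_two X hXs h2; omega
  · have := finrank_prolong_le_four X hXs hX; omega

/-- ★★ **`CaptureIneqSym` FOR TWO LINES AND A SPAN OF DIMENSION ≤ 2.**  `U₀₁ = ℂ·u₁`, `U₀₂ = ℂ·u₂` with `u₁, u₂ ≠ 0` symmetric
(equal or not), `U₁₂` symmetric with `finrank U₁₂ ≤ 2`: every symmetric zero-diagonal `W` captured by `L3 (ℂ∙u₁) (ℂ∙u₂) U₁₂` has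
`finrank W ≤ finrank (ℂ∙u₁) + finrank (ℂ∙u₂) + finrank U₁₂`. [folklore] -/
theorem captureIneqSym_of_two_lines (u₁ u₂ : Fin 5 → Fin 5 → ℂ)
    (hu₁ : ∀ p q, u₁ p q = u₁ q p) (hu₂ : ∀ p q, u₂ p q = u₂ q p) (h₁ : u₁ ≠ 0) (h₂ : u₂ ≠ 0)
    (U12 W : Submodule ℂ (Fin 5 → Fin 5 → ℂ)) (hU12 : ∀ x ∈ U12, ∀ p q : Fin 5, x p q = x q p)
    (hd : Module.finrank ℂ U12 ≤ 2)
    (hWs : ∀ μ ∈ W, ∀ s t : Fin 5, μ s t = μ t s) (hWd : ∀ μ ∈ W, ∀ s : Fin 5, μ s s = 0)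
    (hWc : ∀ μ ∈ W, contractZ μ ∈ L3 (ℂ ∙ u₁) (ℂ ∙ u₂) U12) :
    Module.finrank ℂ W ≤ Module.finrank ℂ (ℂ ∙ u₁) + Module.finrank ℂ (ℂ ∙ u₂) + Module.finrank ℂ U12 := by
  classical
  by_cases hnp : ∃ i j k l, u₁ i j * u₂ k l ≠ u₁ k l * u₂ i j
  · exact captureIneqSym_of_nonproportional_lines u₁ u₂ hu₁ hu₂ hnp U12 W hU12 hd hWs hWd hWc
  -- `u₂ = t • u₁`: the two lines coincide
  push Not at hnp
  have hne : ∃ i j, u₁ i j ≠ 0 := by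
    by_contra h
    push Not at h
    exact h₁ (funext fun p => funext fun q => h p q)
  obtain ⟨i₀, j₀, h0⟩ := hne
  set t : ℂ := u₂ i₀ j₀ / u₁ i₀ j₀ with ht
  have hu₂t : u₂ = t • u₁ := by
    funext k l
    simp only [Pi.smul_apply, smul_eq_mul, ht]
    have := hnp i₀ j₀ k l
    field_simp
    linear_combination this
  have htne : t ≠ 0 := by
    intro h0'; apply h₂; rw [hu₂t, h0', zero_smul]
  have hspan : (ℂ ∙ u₂) = (ℂ ∙ u₁) := by
    rw [hu₂t]; exact Submodule.span_singleton_smul_eq (isUnit_iff_ne_zero.mpr htne) u₁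
  have hWc' : ∀ μ ∈ W, contractZ μ ∈ L3 (ℂ ∙ u₁) (ℂ ∙ u₁) U12 := fun μ hμ => by
    have := hWc μ hμ; rwa [hspan] at this
  rw [finrank_span_singleton h₁, finrank_span_singleton h₂]
  -- the prolongation of `X := U12 ⊔ ℂu₁`
  let X : Submodule ℂ (Fin 5 → Fin 5 → ℂ) := U12 ⊔ (ℂ ∙ u₁)
  have hXs : ∀ x ∈ X, ∀ q r : Fin 5, x q r = x r q := by
    intro x hx q r
    obtain ⟨y, hy, z, hz, rfl⟩ := Submodule.mem_sup.mp hx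
    obtain ⟨c, rfl⟩ := Submodule.mem_span_singleton.mp hz
    simp only [Pi.add_apply, Pi.smul_apply, smul_eq_mul, hU12 y hy q r, hu₁ q r]
  have hP : ∀ G : Fin 5 → Fin 5 → Fin 5 → ℂ, (∀ p q r, G p q r = G q p r) → (∀ p q r, G p q r = G p r q) →
      (∀ p, G p ∈ U12 ⊔ (ℂ ∙ u₁)) → G ∈ prolong X := fun G hG1 hG2 hG3 =>
    (mem_prolong_iff X G).mpr ⟨hG1, hG2, hG3⟩
  by_cases huV : u₁ ∈ U12
  · -- `X = U12`
    have hXeq : X = U12 := sup_eq_left.mpr ((Submodule.span_singleton_le_iff_mem u₁ U12).mpr huV)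
    have hV1 : 1 ≤ Module.finrank ℂ U12 := by
      rw [← finrank_span_singleton (K := ℂ) h₁]
      exact Submodule.finrank_mono ((Submodule.span_singleton_le_iff_mem u₁ U12).mpr huV)
    have hPV : Module.finrank ℂ (prolong X) ≤ Module.finrank ℂ U12 := by
      rw [hXeq]
      by_cases h1 : Module.finrank ℂ U12 ≤ 1
      · exact (finrank_prolong_le_one U12 hU12 h1).trans hV1
      · exact (finrank_prolong_le_two U12 hU12 hd).trans (by omega)
    have h := finrank_le_of_equalPencil_of_mem u₁ hu₁ h₁ U12 W hU12 hd huV hWs hWd hWc' (prolong X) hP hPV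
    omega
  · have h := finrank_le_of_equalPencil_of_not_mem u₁ hu₁ U12 W hU12 huV hWs hWd hWc' (prolong X) hP
    have hXd : Module.finrank ℂ X ≤ Module.finrank ℂ U12 + 1 := by
      have := Submodule.finrank_add_le_finrank_add_finrank U12 (ℂ ∙ u₁)
      rw [finrank_span_singleton h₁] at this
      exact this
    have hP1 := finrank_prolong_le_succ X hXs (by omega)
    omega

end LaplaceFiveSeparatedCapture

end Summit.ValiantsHypothesis.ValiantsHypothesis.Theorems.RigidityForcesSymmetryRankRigidMinimalRepr
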